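import Mathlib
import Literature.MathematicalPhysics.StatisticalMechanics.Crystallization
import Literature.Algebra.EuclideanLattices.LatticePeriodicFunctions

/-!
# Route `HolmgrenBoyleLind`, item `HalfSpaceRigidityPeriodic` — lattice bookkeeping

Helpers for item stmt-AtomisticToContinuum-6077 (`HalfSpaceRigidityPeriodic`): the "periodic
half" of the elementary proof.  For a uniformly discrete (`δ`-separated), relatively dense
(`r`-dense) set `Λ ⊆ ℝ³`:

* `finite_inter_of_le_dist` — `Λ` meets every bounded set in a finite set;
* `exists_periodicConfiguration_of_span_eq_top` — if the group of periods
  `{t | ∀ x, x + t ∈ Λ ↔ x ∈ Λ}` spans `ℝ³`, then it is a full-rank `ℤ`-lattice `G` (discrete because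
  `Λ` is uniformly discrete) and `Λ = F + G` with the finite motif `F = fract_b '' Λ` of
  representatives in the fundamental parallelepiped of a `ℤ`-basis `b` of `G`
  (Baake–Grimm 2013, Prop. 3.1: a uniformly discrete set with `d` independent periods is a finite
  union of translates of a lattice), packaged as a `PeriodicConfiguration 3`;
* `span_periods_eq_top` — if, for some radius `R`, any two points of `Λ` with the same `R`-patch
  differ by a period, then (finite local complexity = finitely many `R`-patches) the periods span
  `ℝ³`: otherwise a unit normal `u` to their span takes only finitely many values `⟪y, u⟫` on `Λ`,
  contradicting relative density.

All `[folklore]`; nothing here closes an item by itself.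
-/

noncomputable section

namespace Summit.AtomisticToContinuum.Crystallization.Theorems.HolmgrenBoyleLind

open scoped BigOperators Topology InnerProductSpace
open Filter Set Metric
open Literature.MathematicalPhysics.StatisticalMechanics

/-- A uniformly discrete subset of `ℝ³` meets every bounded set in a finite set. [folklore] -/
theorem finite_inter_of_le_dist {Λ : Set (EuclideanSpace ℝ (Fin 3))} {δ : ℝ} (hδ : 0 < δ)
    (hsep : ∀ x ∈ Λ, ∀ y ∈ Λ, x ≠ y → δ ≤ dist x y) {K : Set (EuclideanSpace ℝ (Fin 3))}
    (hK : Bornology.IsBounded K) : (K ∩ Λ).Finite := by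
  have hpair : Λ.Pairwise fun x y => δ ≤ dist x y := fun x hx y hy hxy => hsep x hx y hy hxy
  have hdisc : DiscreteTopology Λ :=
    DiscreteTopology.of_forall_le_dist hδ fun x y hxy =>
      hsep x x.2 y y.2 fun h => hxy (Subtype.ext h)
  exact Metric.finite_isBounded_inter_isClosed (isDiscrete_iff_discreteTopology.2 hdisc) hK
    (Metric.isClosed_of_pairwise_le_dist hδ hpair)

/-- A translate `Λ - p = {w | p + w ∈ Λ}` of a `δ`-separated set is `δ`-separated. [folklore] -/
theorem le_dist_of_mem_translate {Λ : Set (EuclideanSpace ℝ (Fin 3))} {δ : ℝ}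
    (hsep : ∀ x ∈ Λ, ∀ y ∈ Λ, x ≠ y → δ ≤ dist x y) (p : EuclideanSpace ℝ (Fin 3)) :
    ∀ x ∈ {w : EuclideanSpace ℝ (Fin 3) | p + w ∈ Λ}, ∀ y ∈ {w : EuclideanSpace ℝ (Fin 3) | p + w ∈ Λ},
      x ≠ y → δ ≤ dist x y := by
  intro x hx y hy hxy
  have h := hsep (p + x) hx (p + y) hy (by simpa using hxy)
  simpa using h

/-- **Full-rank periods ⇒ periodic configuration** (Baake–Grimm 2013, Prop. 3.1, for `ℝ³`): if the
periods of a uniformly discrete, relatively dense `Λ ⊆ ℝ³` span `ℝ³`, then `Λ` is the point set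
`F + G` of a periodic configuration — `G` the (discrete, full-rank) group of periods and `F` the
finite set of representatives of `Λ` in a fundamental parallelepiped of `G`. [folklore] -/
theorem exists_periodicConfiguration_of_span_eq_top {Λ : Set (EuclideanSpace ℝ (Fin 3))} {δ r : ℝ}
    (hδ : 0 < δ) (hsep : ∀ x ∈ Λ, ∀ y ∈ Λ, x ≠ y → δ ≤ dist x y)
    (hden : ∀ c : EuclideanSpace ℝ (Fin 3), ∃ y ∈ Λ, dist y c ≤ r)
    (hspan : Submodule.span ℝ {t : EuclideanSpace ℝ (Fin 3) | ∀ x, x + t ∈ Λ ↔ x ∈ Λ} = ⊤) :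
    ∃ P : PeriodicConfiguration 3, P.points = Λ := by
  classical
  -- the group of periods
  let G₀ : AddSubgroup (EuclideanSpace ℝ (Fin 3)) :=
    { carrier := {t | ∀ x, x + t ∈ Λ ↔ x ∈ Λ}
      add_mem' := fun {s t} hs ht x => by rw [← add_assoc, ht, hs]
      zero_mem' := fun x => by rw [add_zero]
      neg_mem' := fun {t} ht x => by
        have h := ht (x + -t)
        rw [neg_add_cancel_right] at h
        exact h.symm }
  let G : Submodule ℤ (EuclideanSpace ℝ (Fin 3)) := AddSubgroup.toIntSubmodule G₀
  have hmemG : ∀ t, t ∈ G ↔ ∀ x, x + t ∈ Λ ↔ x ∈ Λ := fun t => Iff.rfl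
  have hcoeG : (G : Set (EuclideanSpace ℝ (Fin 3))) = {t | ∀ x, x + t ∈ Λ ↔ x ∈ Λ} := rfl
  obtain ⟨x₀, hx₀, -⟩ := hden 0
  -- `G` is `δ`-separated, hence discrete
  have hGsep : ∀ t ∈ G, t ≠ 0 → δ ≤ ‖t‖ := by
    intro t ht ht0
    have h1 : x₀ + t ∈ Λ := ((hmemG t).1 ht x₀).2 hx₀
    have h2 := hsep (x₀ + t) h1 x₀ hx₀ (by simpa using ht0)
    simpa [dist_eq_norm] using h2
  haveI hGd : DiscreteTopology G := by
    refine DiscreteTopology.of_forall_le_dist hδ ?_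
    intro s t hst
    have hmem : (s : EuclideanSpace ℝ (Fin 3)) - t ∈ G := G.sub_mem s.2 t.2
    have hne : (s : EuclideanSpace ℝ (Fin 3)) - t ≠ 0 := sub_ne_zero.2 fun h => hst (Subtype.ext h)
    have h := hGsep _ hmem hne
    rwa [Subtype.dist_eq, dist_eq_norm]
  haveI hGl : IsZLattice ℝ G := ⟨by rw [hcoeG, hspan]⟩
  -- a `ℤ`-basis of `G` that is an `ℝ`-basis of `ℝ³`, and its fundamental parallelepiped
  let b := Literature.Algebra.EuclideanLattices.LatticePeriodic.rBasis G
  have hbspan : Submodule.span ℤ (Set.range b) = G :=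
    Literature.Algebra.EuclideanLattices.LatticePeriodic.rBasis_span G
  have hfin : (ZSpan.fundamentalDomain b ∩ Λ).Finite :=
    finite_inter_of_le_dist hδ hsep (ZSpan.fundamentalDomain_isBounded b)
  have hfract_mem : ∀ x ∈ Λ, ZSpan.fract b x ∈ Λ := by
    intro x hx
    rw [ZSpan.fract_apply]
    have hfl : ((ZSpan.floor b x : Submodule.span ℤ (Set.range b)) : EuclideanSpace ℝ (Fin 3)) ∈ G := by
      rw [← hbspan]; exact (ZSpan.floor b x).2
    have h := (hmemG _).1 (G.neg_mem hfl) x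
    rw [← sub_eq_add_neg] at h
    exact h.2 hx
  let M : Set (EuclideanSpace ℝ (Fin 3)) := ZSpan.fract b '' Λ
  have hMsub : M ⊆ ZSpan.fundamentalDomain b ∩ Λ := by
    rintro _ ⟨x, hx, rfl⟩
    exact ⟨ZSpan.fract_mem_fundamentalDomain b x, hfract_mem x hx⟩
  have hMfin : M.Finite := hfin.subset hMsub
  refine ⟨{ lattice := G, discrete := hGd, isZLattice := hGl, motif := hMfin.toFinset,
            motif_nonempty := ⟨ZSpan.fract b x₀, hMfin.mem_toFinset.2 ⟨x₀, hx₀, rfl⟩⟩,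
            eq_of_sub_mem := ?_ }, ?_⟩
  · intro x hx y hy hxy
    rw [Set.Finite.mem_toFinset] at hx hy
    obtain ⟨x', hx', rfl⟩ := hx
    obtain ⟨y', hy', rfl⟩ := hy
    rw [← ZSpan.fract_fract b x', ← ZSpan.fract_fract b y', ZSpan.fract_eq_fract, hbspan]
    have h := G.neg_mem hxy
    rwa [neg_sub, sub_eq_neg_add] at h
  · ext z
    simp only [PeriodicConfiguration.points, Set.mem_setOf_eq, Set.Finite.mem_toFinset]
    constructor
    · rintro ⟨y, ⟨x, hx, rfl⟩, g, hg, rfl⟩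
      exact ((hmemG g).1 hg _).2 (hfract_mem x hx)
    · intro hz
      refine ⟨ZSpan.fract b z, ⟨z, hz, rfl⟩,
        ((ZSpan.floor b z : Submodule.span ℤ (Set.range b)) : EuclideanSpace ℝ (Fin 3)), ?_, ?_⟩
      · rw [← hbspan]; exact (ZSpan.floor b z).2
      · rw [ZSpan.fract_apply, sub_add_cancel]

/-- **Rigid patches ⇒ full-rank periods**: if `Λ ⊆ ℝ³` is relatively dense, has finitely many
`R`-patches, and any two points with the same `R`-patch differ by a period of `Λ`, then the periods
of `Λ` span `ℝ³` (a normal vector `u` to their span would make `y ↦ ⟪y, u⟫` finitely-valued on `Λ`,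
which relative density forbids). [folklore] -/
theorem span_periods_eq_top {Λ : Set (EuclideanSpace ℝ (Fin 3))} {r R : ℝ}
    (hden : ∀ c : EuclideanSpace ℝ (Fin 3), ∃ y ∈ Λ, dist y c ≤ r)
    (hFLC : Set.Finite {S : Set (EuclideanSpace ℝ (Fin 3)) |
      ∃ x ∈ Λ, S = {v : EuclideanSpace ℝ (Fin 3) | x + v ∈ Λ ∧ ‖v‖ ≤ R}})
    (hrig : ∀ p ∈ Λ, ∀ q ∈ Λ,
      {v : EuclideanSpace ℝ (Fin 3) | p + v ∈ Λ ∧ ‖v‖ ≤ R} =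
        {v : EuclideanSpace ℝ (Fin 3) | q + v ∈ Λ ∧ ‖v‖ ≤ R} → ∀ x, x + (q - p) ∈ Λ ↔ x ∈ Λ) :
    Submodule.span ℝ {t : EuclideanSpace ℝ (Fin 3) | ∀ x, x + t ∈ Λ ↔ x ∈ Λ} = ⊤ := by
  classical
  by_contra hne
  have hbot : (Submodule.span ℝ {t : EuclideanSpace ℝ (Fin 3) | ∀ x, x + t ∈ Λ ↔ x ∈ Λ})ᗮ ≠ ⊥ := by
    rwa [Ne, Submodule.orthogonal_eq_bot_iff]
  obtain ⟨u, huK, hu0⟩ := (Submodule.ne_bot_iff _).1 hbot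
  have horth : ∀ t : EuclideanSpace ℝ (Fin 3), (∀ x, x + t ∈ Λ ↔ x ∈ Λ) → ⟪t, u⟫_ℝ = 0 :=
    fun t ht => (Submodule.mem_orthogonal _ u).1 huK t (Submodule.subset_span ht)
  -- one representative per `R`-patch class
  set F := {S : Set (EuclideanSpace ℝ (Fin 3)) |
      ∃ x ∈ Λ, S = {v : EuclideanSpace ℝ (Fin 3) | x + v ∈ Λ ∧ ‖v‖ ≤ R}} with hF
  have hrep : ∀ S ∈ F, ∃ x ∈ Λ, S = {v : EuclideanSpace ℝ (Fin 3) | x + v ∈ Λ ∧ ‖v‖ ≤ R} :=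
    fun S hS => hS
  choose! rep hrepΛ hrepS using hrep
  obtain ⟨Mb, hMb⟩ := (hFLC.image fun S => ⟪rep S, u⟫_ℝ).bddAbove
  have hval : ∀ y ∈ Λ, ⟪y, u⟫_ℝ ≤ Mb := by
    intro y hy
    have hSF : {v : EuclideanSpace ℝ (Fin 3) | y + v ∈ Λ ∧ ‖v‖ ≤ R} ∈ F := ⟨y, hy, rfl⟩
    have h1 := hrig (rep _) (hrepΛ _ hSF) y hy (hrepS _ hSF).symm
    have h2 : ⟪y - rep {v : EuclideanSpace ℝ (Fin 3) | y + v ∈ Λ ∧ ‖v‖ ≤ R}, u⟫_ℝ = 0 := horth _ h1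
    rw [inner_sub_left, sub_eq_zero] at h2
    rw [h2]
    exact hMb ⟨_, hSF, rfl⟩
  -- a point of `Λ` far out in the direction `u`
  have hu : 0 < ‖u‖ := norm_pos_iff.2 hu0
  set c : EuclideanSpace ℝ (Fin 3) := ((Mb + r * ‖u‖ + 1) / ‖u‖ ^ 2) • u with hc
  obtain ⟨y, hy, hyc⟩ := hden c
  have hcu : ⟪c, u⟫_ℝ = Mb + r * ‖u‖ + 1 := by
    rw [hc, real_inner_smul_left, real_inner_self_eq_norm_sq]
    field_simp
  have hdiff : |⟪y, u⟫_ℝ - ⟪c, u⟫_ℝ| ≤ r * ‖u‖ := by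
    rw [← inner_sub_left]
    calc |⟪y - c, u⟫_ℝ| ≤ ‖y - c‖ * ‖u‖ := abs_real_inner_le_norm _ _
      _ ≤ r * ‖u‖ := by
        gcongr
        rwa [← dist_eq_norm]
  have h := hval y hy
  rw [abs_le] at hdiff
  linarith [hdiff.1]

end Summit.AtomisticToContinuum.Crystallization.Theorems.HolmgrenBoyleLind

end
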